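import Summits.ResolutionOfSingularities.ResolutionOfSingularities.Theorems.PrimaryDeepTransport
import Literature.AlgebraicGeometry.Resolution.FlatSlicingCriterion
import HarnessLib

/-!
# Primary deep cut — KERNELS (lens-4 g47, node «PrimaryDeepCut», slice S6)

§1 the scheme-level one-step kernel `primary_chart_step`; §2 the tower layer (`primaryFrame_start`,
`primaryFrame_zero_elim`, `primaryFrame_succ`) and LAW F `noTower_primaryDeepSurfaceHugging`.
-/

set_option linter.dupNamespace false

open CategoryTheory CategoryTheory.Limits AlgebraicGeometry TopologicalSpace IsLocalRing
open MvPolynomial Literature.AlgebraicGeometry.Resolution Scheme.IdealSheafData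
open Summit.ResolutionOfSingularities.ResolutionOfSingularities.Theorems
open ForcedTowerClasses DivergentTowerClasses MonomialTowerClasses
open HugDimensionClasses SurfaceShadowClasses SurfaceShadowKernels AbsoluteContactClasses
open Summit.ResolutionOfSingularities.ResolutionOfSingularities.Theses

universe u

namespace Summit.ResolutionOfSingularities.ResolutionOfSingularities.Theorems.HugValuationCut

/-! ## §1 The one-step kernel at a point of the blow-up of a regular point -/

section PointKernel

variable {X X' : Scheme.{0}} [IsLocallyNoetherian X'] (π : X' ⟶ X) (Z K D : X.IdealSheafData)

set_option maxHeartbeats 600000 in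
/-- **THE ONE-STEP KERNEL OF LAW F** (scheme level, tower-free).  `π` the blow-up of the regular point `Z_{π x'} = 𝔪`
(embedding dimension `c + 2` at `π x'`, `𝒪_{x'}` regular), `z` a regular system of parameters at `π x'` whose first `c`
members generate the stalk of `K` (a regular SURFACE germ `𝔭`), `x'` on the strict transform of `K`; `𝓘 = D_{π x'}`
with `𝓘 ⊆ 𝔭^ℓ ∩ 𝔪^(ℓ+e)` (`e ≥ 1`), level-`ℓ` shadow `𝔍` NOT inside `𝔪^(e+1) + 𝔭` and of surface colength `< N + 1`,
and the controlled transform `𝓘' = (σ(𝓘) : g^(ℓ+e)) ⊆ 𝔪'^(ℓ+e)`.  Then the strict transform `𝔭' = (u')` of the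
surface is again a regular-parameter frame with `𝓘' ⊆ 𝔭'^ℓ`, shadow `𝔍'` NOT inside `𝔪'^(e+1) + 𝔭'`, and surface
colength `< N`.  Mechanism: (I2) `𝓘 ⊆ 𝔪^e·𝔭^ℓ`; (T↓) `𝓘' ⊆ 𝔭'^ℓ`; (T♯) `g^e·y ∈ σ(𝔍) + 𝔭' ⇒ y ∈ 𝔍'`; (D1) the
strict transform `𝒪_{x'}/𝔭'` is a prime-localised chart of the point blow-up of the SURFACE `𝒪/𝔭`; (λ↓)+(ν=) the
Hironaka–Spivakovsky near-point inequality and order persistence on that surface chart.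
[cite: CossartPiltant2008, proof of Prop. 4.4] [cite: HunekeSwanson2006, Lemma 14.3.4] [cite: Hironaka1964, Ch. III §3
Lemma 6 p. 238] [cite: Matsumura1987, Thm. 14.2, §16] -/
theorem primary_chart_step (hπ : IsBlowup π Z) (x' : X') [IsRegularLocalRing (X.presheaf.stalk (π.base x'))]
    [IsRegularLocalRing (X'.presheaf.stalk x')]
    (hZ : stalkIdeal Z (π.base x') = maximalIdeal _) {c : ℕ} (z : Fin (c + 2) → X.presheaf.stalk (π.base x'))
    (hz : Ideal.span (Set.range z) = maximalIdeal _)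
    (hrank : (maximalIdeal (X.presheaf.stalk (π.base x'))).spanFinrank = c + 2)
    (hK : Ideal.span (Set.range (z ∘ Fin.castAdd 2)) = stalkIdeal K (π.base x'))
    (hx' : x' ∈ ((strictTransformIdeal π Z K).support : Set X')) {ℓ e N : ℕ} (he : 1 ≤ e)
    (hI : stalkIdeal D (π.base x') ≤ Ideal.span (Set.range (z ∘ Fin.castAdd 2)) ^ ℓ)
    (hIm : stalkIdeal D (π.base x') ≤ maximalIdeal _ ^ (ℓ + e))
    (hnd : ¬ levelShadow (Ideal.span (Set.range (z ∘ Fin.castAdd 2))) (stalkIdeal D (π.base x')) ℓ ≤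
      maximalIdeal _ ^ (e + 1) ⊔ Ideal.span (Set.range (z ∘ Fin.castAdd 2)))
    (hlen : Module.length (X.presheaf.stalk (π.base x') ⧸ Ideal.span (Set.range (z ∘ Fin.castAdd 2)))
      ((X.presheaf.stalk (π.base x') ⧸ Ideal.span (Set.range (z ∘ Fin.castAdd 2))) ⧸
        (levelShadow (Ideal.span (Set.range (z ∘ Fin.castAdd 2))) (stalkIdeal D (π.base x')) ℓ).map
          (Ideal.Quotient.mk (Ideal.span (Set.range (z ∘ Fin.castAdd 2))))) < (N + 1 : ℕ))
    (hI'm : stalkIdeal (controlledTransform π Z D (ℓ + e)) x' ≤ maximalIdeal _ ^ (ℓ + e)) :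
    ∃ u' : Fin c → X'.presheaf.stalk x',
      IsRsopPart u' ∧ Ideal.span (Set.range u') = stalkIdeal (strictTransformIdeal π Z K) x' ∧
      stalkIdeal (controlledTransform π Z D (ℓ + e)) x' ≤ Ideal.span (Set.range u') ^ ℓ ∧
      ¬ levelShadow (Ideal.span (Set.range u')) (stalkIdeal (controlledTransform π Z D (ℓ + e)) x') ℓ ≤
        maximalIdeal _ ^ (e + 1) ⊔ Ideal.span (Set.range u') ∧
      Module.length (X'.presheaf.stalk x' ⧸ Ideal.span (Set.range u'))
        ((X'.presheaf.stalk x' ⧸ Ideal.span (Set.range u')) ⧸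
          (levelShadow (Ideal.span (Set.range u')) (stalkIdeal (controlledTransform π Z D (ℓ + e)) x') ℓ).map
            (Ideal.Quotient.mk (Ideal.span (Set.range u')))) < (N : ℕ) := by
  obtain ⟨jb, 𝔴, χ, hχ, hloc, h𝔴, h𝔴t, hgnzd, hzt, hsnoc, h𝔭', hI'⟩ :=
    surface_chart_data π Z K D hπ x' hZ z hz hrank hK hx' (ℓ + e)
  letI := χ.toAlgebra
  haveI : IsLocalization.AtPrime (X'.presheaf.stalk x') 𝔴.asIdeal := hloc
  have hχa : (algebraMap (chartRing z (Fin.natAdd c jb)) (X'.presheaf.stalk x') : _ →+* _) = χ :=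
    RingHom.algebraMap_toAlgebra χ
  -- the two frames `u = z ∘ castAdd 2` (at `π x'`) and `u'` (at `x'`), `g = σ(z_j)`
  have hu : IsRsopPart (z ∘ Fin.castAdd 2) :=
    (isRsopPart_full z hz hrank).comp (Fin.castAdd 2) (Fin.castAdd_injective _ _)
  have hu' : IsRsopPart (fun s : Fin c => χ (chartGen z (Fin.natAdd c jb) (Fin.castAdd 2 s))) := by
    have h1 := hsnoc.comp Fin.castSucc (Fin.castSucc_injective _)
    have h2 : (Fin.snoc (fun s : Fin c => χ (chartGen z (Fin.natAdd c jb) (Fin.castAdd 2 s)))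
        ((π.stalkMap x').hom (z (Fin.natAdd c jb))) : Fin (c + 1) → _) ∘ Fin.castSucc =
        fun s : Fin c => χ (chartGen z (Fin.natAdd c jb) (Fin.castAdd 2 s)) := by
      funext t; simp only [Function.comp_apply, Fin.snoc_castSucc]
    rwa [h2] at h1
  have huu' : ∀ s : Fin c, (π.stalkMap x').hom ((z ∘ Fin.castAdd 2) s) =
      (π.stalkMap x').hom (z (Fin.natAdd c jb)) * χ (chartGen z (Fin.natAdd c jb) (Fin.castAdd 2 s)) :=
    fun s => hzt (Fin.castAdd 2 s)
  -- the image of `𝔪` is `(g)`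
  have hM : (maximalIdeal _).map (π.stalkMap x').hom ≤ Ideal.span {(π.stalkMap x').hom (z (Fin.natAdd c jb))} := by
    rw [← hz, Ideal.map_span, Ideal.span_le]
    rintro _ ⟨_, ⟨t, rfl⟩, rfl⟩
    rw [SetLike.mem_coe, Ideal.mem_span_singleton']
    exact ⟨χ (chartGen z (Fin.natAdd c jb) t), by rw [mul_comm]; exact (hzt t).symm⟩
  -- (I2) at `π x'` and the shadow bound `𝔍 ⊆ 𝔪^e + 𝔭`
  have hIM : stalkIdeal D (π.base x') ≤ maximalIdeal _ ^ e * Ideal.span (Set.range (z ∘ Fin.castAdd 2)) ^ ℓ :=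
    fun a ha => pow_add_inf_pow_le_pow_mul_pow hu ℓ e ⟨hIm ha, hI ha⟩
  have h𝔍 : levelShadow (Ideal.span (Set.range (z ∘ Fin.castAdd 2))) (stalkIdeal D (π.base x')) ℓ ≤
      maximalIdeal _ ^ e ⊔ Ideal.span (Set.range (z ∘ Fin.castAdd 2)) :=
    levelShadow_le le_sup_right (hIM.trans (Ideal.mul_mono_left le_sup_left))
  -- (T↓)
  have hI'p : stalkIdeal (controlledTransform π Z D (ℓ + e)) x' ≤
      Ideal.span (Set.range fun s : Fin c => χ (chartGen z (Fin.natAdd c jb) (Fin.castAdd 2 s))) ^ ℓ :=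
    transform_le_pow_of_map_le _ _ _ hgnzd _ _ ℓ e hI'
      (map_le_span_pow_mul_pow _ (z ∘ Fin.castAdd 2) _ _ huu' _ ℓ e hM hIM)
  -- (I2) at `x'` and the shadow bound `𝔍' ⊆ 𝔪'^e + 𝔭'`
  have hIM' : stalkIdeal (controlledTransform π Z D (ℓ + e)) x' ≤ maximalIdeal _ ^ e *
      Ideal.span (Set.range fun s : Fin c => χ (chartGen z (Fin.natAdd c jb) (Fin.castAdd 2 s))) ^ ℓ :=
    fun a ha => pow_add_inf_pow_le_pow_mul_pow hu' ℓ e ⟨hI'm ha, hI'p ha⟩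
  have h𝔍' : levelShadow (Ideal.span (Set.range fun s : Fin c => χ (chartGen z (Fin.natAdd c jb) (Fin.castAdd 2 s))))
      (stalkIdeal (controlledTransform π Z D (ℓ + e)) x') ℓ ≤ maximalIdeal _ ^ e ⊔
        Ideal.span (Set.range fun s : Fin c => χ (chartGen z (Fin.natAdd c jb) (Fin.castAdd 2 s))) :=
    levelShadow_le le_sup_right (hIM'.trans (Ideal.mul_mono_left le_sup_left))
  -- divisibility of `σ(𝔪^(ℓ+e))` by `g^(ℓ+e)`
  have hdiv : ∀ f, f ∈ maximalIdeal _ ^ (ℓ + e) →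
      ∃ f'', (π.stalkMap x').hom f = (π.stalkMap x').hom (z (Fin.natAdd c jb)) ^ (ℓ + e) * f'' := by
    intro f hf
    have h1 : (π.stalkMap x').hom f ∈ Ideal.span {(π.stalkMap x').hom (z (Fin.natAdd c jb)) ^ (ℓ + e)} := by
      rw [← Ideal.span_singleton_pow]
      have h2 : (maximalIdeal _ ^ (ℓ + e)).map (π.stalkMap x').hom ≤
          Ideal.span {(π.stalkMap x').hom (z (Fin.natAdd c jb))} ^ (ℓ + e) := by
        rw [Ideal.map_pow]; exact Ideal.pow_right_mono hM _
      exact h2 (Ideal.mem_map_of_mem _ hf)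
    obtain ⟨a, ha⟩ := Ideal.mem_span_singleton'.mp h1
    exact ⟨a, by rw [← ha, mul_comm]⟩
  -- (T♯)
  have hT : ∀ y, (π.stalkMap x').hom (z (Fin.natAdd c jb)) ^ e * y ∈
      (levelShadow (Ideal.span (Set.range (z ∘ Fin.castAdd 2))) (stalkIdeal D (π.base x')) ℓ).map
        (π.stalkMap x').hom ⊔
        Ideal.span (Set.range fun s : Fin c => χ (chartGen z (Fin.natAdd c jb) (Fin.castAdd 2 s))) →
      y ∈ levelShadow (Ideal.span (Set.range fun s : Fin c => χ (chartGen z (Fin.natAdd c jb) (Fin.castAdd 2 s))))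
        (stalkIdeal (controlledTransform π Z D (ℓ + e)) x') ℓ := fun y hy =>
    mem_levelShadow_transform_of_pow_mul_mem _ (z ∘ Fin.castAdd 2) _ _ hgnzd huu' _ _ ℓ e hI' hu'.isQuasiRegular
      (fun s hs => mem_span_of_pow_mul_mem hsnoc hs) hI (fun f hf => hdiv f (hIm hf)) hy
  -- (D1) the surfaces `S̄ = 𝒪/𝔭` (regular, dimension two, parameters `c̄`) and `S̄' = 𝒪'/𝔭'`
  haveI hS : IsRegularLocalRing (X.presheaf.stalk (π.base x') ⧸ surfIdeal z) := hu.isRegularLocalRing_quotient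
  have hdS : (maximalIdeal (X.presheaf.stalk (π.base x') ⧸ surfIdeal z)).spanFinrank = 2 :=
    spanFinrank_maximalIdeal_surface z hz hrank
  have hcS : Ideal.span (Set.range (surfParam z)) = maximalIdeal _ := span_range_surfParam z hz
  have hP𝔭' := (surfaceChart_isPrime z jb (X'.presheaf.stalk x') hz hrank 𝔴.asIdeal h𝔴 h𝔴t).1
  haveI : IsDomain (X'.presheaf.stalk x' ⧸ surfTransformIdeal z jb (X'.presheaf.stalk x')) :=
    (Ideal.Quotient.isDomain_iff_prime _).mpr hP𝔭'
  haveI hS'loc : IsLocalRing (X'.presheaf.stalk x' ⧸ surfTransformIdeal z jb (X'.presheaf.stalk x')) :=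
    IsLocalRing.of_surjective' (Ideal.Quotient.mk _) Ideal.Quotient.mk_surjective
  obtain ⟨𝔴', ψ, hP1, hP2, -, hP4, hloc'⟩ :=
    exists_surfaceChart_presentation z jb (X'.presheaf.stalk x') hz hrank 𝔴.asIdeal h𝔴 h𝔴t
  -- `u'` versus the `surfTransformIdeal` spelling
  have hu'eq : (fun s : Fin c => χ (chartGen z (Fin.natAdd c jb) (Fin.castAdd 2 s))) = fun s : Fin c =>
      (algebraMap (chartRing z (Fin.natAdd c jb)) (X'.presheaf.stalk x') : chartRing z (Fin.natAdd c jb) →+* _)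
        (chartGen z (Fin.natAdd c jb) (Fin.castAdd 2 s)) := by
    funext s; rw [hχa]
  have h𝔭'def : surfTransformIdeal z jb (X'.presheaf.stalk x') =
      Ideal.span (Set.range fun s : Fin c => χ (chartGen z (Fin.natAdd c jb) (Fin.castAdd 2 s))) := by
    rw [surfTransformIdeal_def, hu'eq]
  -- hypotheses of the abstract colength theorem
  have h𝔴'le : (maximalIdeal (X.presheaf.stalk (π.base x') ⧸ surfIdeal z)).map (chartBase (surfParam z) jb) ≤
      𝔴'.asIdeal := by
    rw [← map_maximalIdeal_of_surjective (Ideal.Quotient.mk (surfIdeal z)) Ideal.Quotient.mk_surjective,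
      Ideal.map_map, Ideal.map_le_iff_le_comap]
    intro r hr
    exact hP4 r hr
  have hCe : (levelShadow (Ideal.span (Set.range (z ∘ Fin.castAdd 2))) (stalkIdeal D (π.base x')) ℓ).map
      (Ideal.Quotient.mk (surfIdeal z)) ≤ maximalIdeal _ ^ e := (map_mk_le_pow_iff (surfIdeal z) _ e).mpr h𝔍
  have hCe' : ¬ (levelShadow (Ideal.span (Set.range (z ∘ Fin.castAdd 2))) (stalkIdeal D (π.base x')) ℓ).map
      (Ideal.Quotient.mk (surfIdeal z)) ≤ maximalIdeal _ ^ (e + 1) := fun h =>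
    hnd ((map_mk_le_pow_iff (surfIdeal z) _ (e + 1)).mp h)
  have hfin : IsFiniteLength (X.presheaf.stalk (π.base x') ⧸ surfIdeal z)
      ((X.presheaf.stalk (π.base x') ⧸ surfIdeal z) ⧸
        (levelShadow (Ideal.span (Set.range (z ∘ Fin.castAdd 2))) (stalkIdeal D (π.base x')) ℓ).map
          (Ideal.Quotient.mk (surfIdeal z))) :=
    Module.length_ne_top_iff.mp (ne_top_of_lt hlen)
  have hC'e : (levelShadow (Ideal.span (Set.range fun s : Fin c => χ (chartGen z (Fin.natAdd c jb) (Fin.castAdd 2 s))))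
      (stalkIdeal (controlledTransform π Z D (ℓ + e)) x') ℓ).map
      (Ideal.Quotient.mk (surfTransformIdeal z jb (X'.presheaf.stalk x'))) ≤ maximalIdeal _ ^ e := by
    refine (map_mk_le_pow_iff (surfTransformIdeal z jb (X'.presheaf.stalk x')) _ e).mpr ?_
    rw [h𝔭'def]; exact h𝔍'
  have hg : ψ (chartBase (surfParam z) jb (surfParam z jb)) =
      Ideal.Quotient.mk _ ((π.stalkMap x').hom (z (Fin.natAdd c jb))) := by
    have h := hP1 (z (Fin.natAdd c jb))
    rw [hχa, hχ] at h
    exact h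
  have hcomp : (ψ.comp (chartBase (surfParam z) jb)).comp (Ideal.Quotient.mk (surfIdeal z)) =
      (Ideal.Quotient.mk (surfTransformIdeal z jb (X'.presheaf.stalk x'))).comp (π.stalkMap x').hom := by
    ext r
    simp only [RingHom.comp_apply, hP1, hχa, hχ]
  have hC' : ∀ y, ψ (chartBase (surfParam z) jb (surfParam z jb)) ^ e * y ∈
      ((levelShadow (Ideal.span (Set.range (z ∘ Fin.castAdd 2))) (stalkIdeal D (π.base x')) ℓ).map
        (Ideal.Quotient.mk (surfIdeal z))).map (ψ.comp (chartBase (surfParam z) jb)) →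
      y ∈ (levelShadow (Ideal.span (Set.range fun s : Fin c => χ (chartGen z (Fin.natAdd c jb) (Fin.castAdd 2 s))))
        (stalkIdeal (controlledTransform π Z D (ℓ + e)) x') ℓ).map
        (Ideal.Quotient.mk (surfTransformIdeal z jb (X'.presheaf.stalk x'))) := by
    intro y hy
    obtain ⟨y, rfl⟩ := Ideal.Quotient.mk_surjective y
    rw [hg, Ideal.map_map, hcomp, ← Ideal.map_map, ← map_pow, ← map_mul, Ideal.mem_quotient_iff_mem_sup,
      h𝔭'def] at hy
    exact Ideal.mem_map_of_mem _ (hT y hy)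
  -- (λ↓)+(ν=)
  obtain ⟨hlt, hne⟩ := length_lt_of_surfaceChart hdS (surfParam z) hcS jb ψ 𝔴'.asIdeal hloc' h𝔴'le he hCe hCe'
    hfin hC' hC'e
  have hN : Module.length (X.presheaf.stalk (π.base x') ⧸ surfIdeal z)
      ((X.presheaf.stalk (π.base x') ⧸ surfIdeal z) ⧸
        (levelShadow (Ideal.span (Set.range (z ∘ Fin.castAdd 2))) (stalkIdeal D (π.base x')) ℓ).map
          (Ideal.Quotient.mk (surfIdeal z))) ≤ (N : ℕ) := by
    have h1 : ((N + 1 : ℕ) : ℕ∞) = (N : ℕ∞) + 1 := by push_cast; rfl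
    have h2 := hlen
    rw [h1] at h2
    exact (ENat.lt_add_one_iff (ENat.coe_ne_top N)).mp h2
  refine ⟨fun s : Fin c => χ (chartGen z (Fin.natAdd c jb) (Fin.castAdd 2 s)), hu', h𝔭', hI'p, fun h => hne ?_, ?_⟩
  · refine (map_mk_le_pow_iff (surfTransformIdeal z jb (X'.presheaf.stalk x')) _ (e + 1)).mpr ?_
    rw [h𝔭'def]; exact h
  · rw [← h𝔭'def]
    exact hlt.trans_le hN

end PointKernel

/-! ## §2 The tower layer: START, END, STEP and LAW F -/

section Tower

variable {k : Type} [Field k]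

/-- **START**: a primarily-deeply hugged regular surface germ yields a primary frame at stage `m` (the `𝔪`-primary
shadow has finite surface colength). [cite: Matsumura1987, Thm. 14.2, §16] -/
theorem primaryFrame_start (T : ForcedTower) (g : T.St 0 ⟶ Spec (.of k)) (hB : IsBase (T.St 0) g)
    {m : ℕ} {H : (T.St m).IdealSheafData} (hH : HugsGerm T m H) {ℓ e : ℕ}
    (hd2 : ringKrullDim ((T.St m).presheaf.stalk (T.pt m) ⧸ stalkIdeal H (T.pt m)) = (2 : WithBot ℕ∞))
    [IsRegularLocalRing ((T.St m).presheaf.stalk (T.pt m) ⧸ stalkIdeal H (T.pt m))]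
    (hIP : stalkIdeal (T.D m).ideal (T.pt m) ≤ stalkIdeal H (T.pt m) ^ ℓ)
    (hprim : ∃ N₀ : ℕ, maximalIdeal _ ^ N₀ ≤ levelShadow (stalkIdeal H (T.pt m)) (stalkIdeal (T.D m).ideal (T.pt m)) ℓ)
    (hord : ¬ levelShadow (stalkIdeal H (T.pt m)) (stalkIdeal (T.D m).ideal (T.pt m)) ℓ ≤
      maximalIdeal _ ^ (e + 1) ⊔ stalkIdeal H (T.pt m)) :
    ∃ c N : ℕ, PrimaryFrame T ℓ e m H 0 c N := by
  haveI := (tower_isLocallyNoetherian_isRegular T g hB m).2 (T.pt m)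
  have hle : stalkIdeal H (T.pt m) ≤ maximalIdeal _ := (mem_support_iff_stalkIdeal_le _ _).mp (hH.2 0)
  obtain ⟨c, u, hu, hHu⟩ := exists_isRsopPart_of_isRegularLocalRing_quotient hle
  have hdim : ringKrullDim ((T.St m).presheaf.stalk (T.pt m)) = (c + 2 : ℕ) := by
    have h := hu.ringKrullDim_quotient_add
    rw [← hHu, hd2] at h
    rw [← h]
    push_cast
    rw [add_comm]
  obtain ⟨N₀, hN₀⟩ := hprim
  rw [hHu] at hIP hord hN₀
  haveI hS : IsRegularLocalRing ((T.St m).presheaf.stalk (T.pt m) ⧸ Ideal.span (Set.range u)) :=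
    hu.isRegularLocalRing_quotient
  have hfin : IsFiniteLength ((T.St m).presheaf.stalk (T.pt m) ⧸ Ideal.span (Set.range u))
      (((T.St m).presheaf.stalk (T.pt m) ⧸ Ideal.span (Set.range u)) ⧸
        (levelShadow (Ideal.span (Set.range u)) (stalkIdeal (T.D m).ideal (T.pt m)) ℓ).map
          (Ideal.Quotient.mk (Ideal.span (Set.range u)))) :=
    Matsumura1987.isFiniteLength_quotient_of_pow_le (pow_le_map_mk_of_pow_le (Ideal.span (Set.range u)) hN₀)
  obtain ⟨N, hN⟩ := ENat.ne_top_iff_exists.mp (Module.length_ne_top_iff.mpr hfin)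
  refine ⟨c, N + 1, u, hu, hHu.symm, hdim, hIP, hord, ?_⟩
  show Module.length ((T.St m).presheaf.stalk (T.pt m) ⧸ Ideal.span (Set.range u))
      (((T.St m).presheaf.stalk (T.pt m) ⧸ Ideal.span (Set.range u)) ⧸
        (levelShadow (Ideal.span (Set.range u)) (stalkIdeal (T.D m).ideal (T.pt m)) ℓ).map
          (Ideal.Quotient.mk (Ideal.span (Set.range u)))) < ((N + 1 : ℕ) : ℕ∞)
  rw [← hN]
  exact_mod_cast Nat.lt_succ_self N

/-- **END**: a primary frame with colength bound `N = 0` is absurd. [folklore] -/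
theorem primaryFrame_zero_elim (T : ForcedTower) {ℓ e m : ℕ} {H : (T.St m).IdealSheafData} {j c : ℕ}
    (h : PrimaryFrame T ℓ e m H j c 0) : False := by
  obtain ⟨u, -, -, -, -, -, hlen⟩ := h
  rw [Nat.cast_zero] at hlen
  exact (not_le.mpr hlen) zero_le

set_option maxHeartbeats 400000 in
/-- **STEP** (the heart of LAW F): a primary frame with colength bound `N + 1` at stage `m + j` yields one with bound
`N` at stage `m + j + 1`, by the one-step kernel `primary_chart_step` applied to the blow-up `T.π (m + j)` of the
closed point `pt (m + j)`. [cite: CossartPiltant2008, proof of Prop. 4.4] [cite: HunekeSwanson2006, Lemma 14.3.4]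
[cite: Hironaka1964, Ch. III §3] [cite: Matsumura1987, Thm. 14.2, §16] -/
theorem primaryFrame_succ (T : ForcedTower) (g : T.St 0 ⟶ Spec (.of k)) (hB : IsBase (T.St 0) g) {n : ℕ}
    (hD : IsDatum n (T.D 0)) (hn : 1 ≤ n) {m : ℕ} {H : (T.St m).IdealSheafData} (hH : HugsGerm T m H)
    {ℓ e : ℕ} (he : 1 ≤ e) (hℓe : ℓ + e = n) {j c N : ℕ} (h : PrimaryFrame T ℓ e m H j c (N + 1)) :
    PrimaryFrame T ℓ e m H (j + 1) c N := by
  obtain ⟨u, hu₀, hpu₀, hdim₀, hIp₀, hnd₀, hlen₀⟩ := h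
  -- re-elaborate the frame hypotheses in this context
  have hu : IsRsopPart u := hu₀
  have hpu : Ideal.span (Set.range u) = stalkIdeal (strictIter T m H j) (T.pt (m + j)) := hpu₀
  have hdim : ringKrullDim ((T.St (m + j)).presheaf.stalk (T.pt (m + j))) = (c + 2 : ℕ) := hdim₀
  have hIp : stalkIdeal (T.D (m + j)).ideal (T.pt (m + j)) ≤ Ideal.span (Set.range u) ^ ℓ := hIp₀
  have hnd : ¬ levelShadow (Ideal.span (Set.range u)) (stalkIdeal (T.D (m + j)).ideal (T.pt (m + j))) ℓ ≤
      maximalIdeal _ ^ (e + 1) ⊔ Ideal.span (Set.range u) := hnd₀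
  have hlen : Module.length ((T.St (m + j)).presheaf.stalk (T.pt (m + j)) ⧸ Ideal.span (Set.range u))
      (((T.St (m + j)).presheaf.stalk (T.pt (m + j)) ⧸ Ideal.span (Set.range u)) ⧸
        (levelShadow (Ideal.span (Set.range u)) (stalkIdeal (T.D (m + j)).ideal (T.pt (m + j))) ℓ).map
          (Ideal.Quotient.mk (Ideal.span (Set.range u)))) < (N + 1 : ℕ) := hlen₀
  clear hu₀ hpu₀ hdim₀ hIp₀ hnd₀ hlen₀
  -- stage `m + j`
  have hIm : stalkIdeal (T.D (m + j)).ideal (T.pt (m + j)) ≤ maximalIdeal _ ^ (ℓ + e) := by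
    rw [hℓe]; exact tower_stalkIdeal_le_pow T hD (m + j)
  have hZst : stalkIdeal (T.centre (m + j)) (T.pt (m + j)) = maximalIdeal _ := by
    rw [tower_centre_eq_vanishingIdeal T (m + j)]
    exact stalkIdeal_vanishingIdeal_singleton (T.isClosed_pt _)
  have hDeq : (T.D (m + (j + 1))).ideal =
      controlledTransform (T.π (m + j)) (T.centre (m + j)) (T.D (m + j)).ideal (ℓ + e) := by
    show (T.D (m + j + 1)).ideal = _
    rw [T.transform_eq (m + j), MarkedIdeal.transform_ideal, tower_mult_eq T hD (m + j), hℓe]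
  -- stage `m + j + 1`
  haveI hX' : IsLocallyNoetherian (T.St (m + j + 1)) := (tower_isLocallyNoetherian_isRegular T g hB (m + j + 1)).1
  haveI hS : IsRegularLocalRing ((T.St (m + j + 1)).presheaf.stalk (T.pt (m + (j + 1)))) :=
    (tower_isLocallyNoetherian_isRegular T g hB (m + j + 1)).2 _
  have hdimS : ringKrullDim ((T.St (m + j + 1)).presheaf.stalk (T.pt (m + (j + 1)))) = (c + 2 : ℕ) := by
    have h1 := tower_ringKrullDim_pt_eq T g hB hD hn (m + (j + 1))
    have h2 := tower_ringKrullDim_pt_eq T g hB hD hn (m + j)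
    rw [hdim] at h2
    exact h1.trans h2.symm
  have hx'K : T.pt (m + (j + 1)) ∈
      ((strictTransformIdeal (T.π (m + j)) (T.centre (m + j)) (strictIter T m H j)).support : Set _) := hH.2 (j + 1)
  have hI'm : stalkIdeal (T.D (m + (j + 1))).ideal (T.pt (m + (j + 1))) ≤ maximalIdeal _ ^ (ℓ + e) := by
    rw [hℓe]; exact tower_stalkIdeal_le_pow T hD (m + (j + 1))
  rw [hDeq] at hI'm
  -- move all stage-`(m + j)` data to the base point `π x'`
  have hy : (T.π (m + j)).base (T.pt (m + (j + 1))) = T.pt (m + j) := T.pt_map (m + j)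
  generalize hx : T.pt (m + j) = x at u hu hpu hdim hIp hnd hlen hIm hZst hy
  subst hy
  haveI hR : IsRegularLocalRing ((T.St (m + j)).presheaf.stalk ((T.π (m + j)).base (T.pt (m + (j + 1))))) :=
    (tower_isLocallyNoetherian_isRegular T g hB (m + j)).2 _
  have hrank : (maximalIdeal ((T.St (m + j)).presheaf.stalk ((T.π (m + j)).base (T.pt (m + (j + 1)))))).spanFinrank =
      c + 2 := by
    have h1 := IsRegularLocalRing.spanFinrank_maximalIdeal
      (R := (T.St (m + j)).presheaf.stalk ((T.π (m + j)).base (T.pt (m + (j + 1)))))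
    rw [hdim] at h1
    exact_mod_cast h1
  -- a full regular system of parameters `zz` extending `u = zz ∘ castAdd 2`
  obtain ⟨e₀, zz, hzrank, hzz, hzzu⟩ := hu.exists_rsop
  obtain rfl : e₀ = 2 := by omega
  obtain rfl : zz ∘ Fin.castAdd 2 = u := funext hzzu
  -- the one-step kernel
  obtain ⟨u', hu', hpu', hI'p, hnd', hlen'⟩ :=
    primary_chart_step (T.π (m + j)) (T.centre (m + j)) (strictIter T m H j) (T.D (m + j)).ideal
      (T.isBlowup (m + j)) (T.pt (m + (j + 1))) hZst zz hzz hzrank hpu hx'K he hIp hIm hnd hlen hI'm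
  refine ⟨u', hu', hpu', hdimS, ?_, ?_, ?_⟩
  · rw [hDeq]; exact hI'p
  · rw [hDeq]; exact hnd'
  · rw [hDeq]; exact hlen'

/-- **LAW F · `noTower_primaryDeepSurfaceHugging`** (hypothesis-free, every weight, all characteristics, every
dimension): no infinite forced tower hugs a regular surface germ primarily-deeply — the surface colength of the
`𝔪`-primary level shadow of surface order exactly `e` drops at every blow-up (Hironaka–Spivakovsky).
[cite: CossartPiltant2008, Prop. 4.4] [cite: HunekeSwanson2006, Lemma 14.3.4] [cite: Hironaka1964, Ch. III §3]
[cite: Matsumura1987, Thm. 14.2, §16] -/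
theorem noTower_primaryDeepSurfaceHugging (n : ℕ) : NoTower n PrimaryDeepSurfaceHugging := by
  intro p _ k _ _ T g hB hD _ hP
  obtain ⟨m, H, ℓ, e, hH, hd2, hreg, he2, hℓe, hIP, hprim, hord⟩ := hP
  haveI := hreg
  have hℓe' : ℓ + e = n := by rw [hℓe]; exact tower_mult_eq T hD m
  have hn : 1 ≤ n := by omega
  obtain ⟨c, N, h0⟩ := primaryFrame_start T g hB hH hd2 hIP hprim hord
  have key : ∀ N j, PrimaryFrame T ℓ e m H j c N → False := by
    intro N
    induction N with
    | zero => intro j h; exact primaryFrame_zero_elim T h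
    | succ N ih => intro j h; exact ih (j + 1) (primaryFrame_succ T g hB hD hn hH (by omega) hℓe' h)
  exact key N 0 h0

/-- LAW F in the `PrimaryDeepSurfaceLaw` spelling. [cite: CossartPiltant2008, Prop. 4.4] -/
theorem primaryDeepSurfaceLaw (n : ℕ) : PrimaryDeepSurfaceLaw n := noTower_primaryDeepSurfaceHugging n

end Tower

end Summit.ResolutionOfSingularities.ResolutionOfSingularities.Theorems.HugValuationCut
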